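import Summits.BirchSwinnertonDyer.Rank1Residual.X11a.SelmerCompanionShapes
import Summits.BirchSwinnertonDyer.Rank1Residual.X2.GreenbergVatsalTateDatumRat
import Literature.NumberTheory.EllipticCurves.SelmerInertiaProofs
import Literature.NumberTheory.EllipticCurves.UnramifiedLayerRootsProofs
import Mathlib.FieldTheory.Galois.Infinite
import HarnessLib

/-!
# Route (3e) SELMER COMPANION, IV: at a NON-SPLIT multiplicative place `v ∤ p` the Kummer classes
# are unramified (lemma L-ns of the census), and the fourth kind of place (class X11a = N7; cell
# `b2b-bsdres`, unit `b2b-bsdres-x11a`, gen 26)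

HONEST FRAMING (run/shared/lean/b2b/bsd-rank1-residual/, verbatim in every file): the goal of the
cell is to DELETE the COMBINATION-SHAPED residual classes of the Birch–Swinnerton-Dyer formula for
ALL analytic-rank `≤ 1` elliptic curves over `ℚ` — "full BSD formula for every rank `≤ 1` curve in
class `C`" assembled STRICTLY from published theorems — so that the rank-`≤ 1` remainder becomes
exactly the CONSTRUCTION-SHAPED classes, which are TYPED (missing-input `Prop`s), NOT attempted.
This is not "finishing BSD". CLASS-OWNERS.md: research routes; NO CLAIM BEYOND STATED CLASSES.
THEOREMS ONLY; nothing booked; no label moves. CONDITIONAL on the PUBLISHED named fact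
`Silverman1994_thmV53_corV54_tateUniformisation` (twisted Tate uniformisation, `hU`) where it is a
hypothesis.

## The lemma (`selmerLocalKer_le_unramifiedKer_primeBelow_of_nonsplit`)

Let `E = W` be an elliptic curve over a number field `K`, `p` an odd prime, `v ∤ p` a finite place
at which `E` has NON-SPLIT multiplicative reduction — multiplicative, with `γ(E) = −c₄/c₆` NOT a
square in `K_v` — and at which the local inertia group fixes `√γ` (the twisting quadratic extension
`K_v(√γ)/K_v` is unramified; automatic at odd residue characteristic, tree
`X2.GreenbergVatsalTateDatumRat.inertia_fix_sqrt_gamma` over `ℚ`). Then every global class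
`c ∈ H¹(K, E[p])` satisfying the local Selmer condition at `v` is UNRAMIFIED at (the prime below
the canonical embedding over) `v`: `𝓢_v(E) ≤ unramifiedKer (E[p]) 𝔓_v`.

Proof (Silverman *ATAEC* V.5.3/5.4 through the tree's twisted-parametrisation algebra of
`CongruenceVisibilityMultiplicativeTwisted.lean`): locally `c` is `σ ↦ σa' − a'`; with
`a₁ = (p+1)a'` the rational point `p a₁` is `Ψ(u')` for a unit `u'` of `K̄_v` INVARIANT under the
twisted action (`exists_twistInvariant_lift`; `|u'|_v = 1` BECAUSE some `σ₀` moves `√γ`, so that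
`σ₀ u' = u'⁻¹` — this is where non-split enters: for a split curve the uniformiser's Kummer class IS
ramified); for a `p`-th root `w` of `u'` the cocycle is `Ψ(ζ_σ) + (σT − T)` with `σw = ζ_σ w` on the
subgroup fixing `√γ`, `ζ_σ ∈ μ_p`, `T ∈ E[p]`; and for `σ` in the INERTIA group `ζ_σ = 1`, because
inertia fixes `√γ`, moves the unit `w` by less than `1` (`mem_inertia_iff_spectralValuation`) and two
distinct `p`-th roots of unity are at distance `1` when `v ∤ p` (`eq_one_of_pow_eq_one_of_val_sub_lt_one`).
So `c` restricted to inertia is the coboundary of `T`: unramified. (Equivalently: every `K_v`-point of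
a non-split Tate curve is `p`-divisible in `E(K_v^nr)`, `p` odd, `v ∤ p`.)

## Use: the fourth kind of place

`h1Equiv_mem_selmerLocalKer_of_nonsplit_of_good`: for `θ : E[p] ≃ A[p]` with `E` non-split
multiplicative and `A` GOOD at `v ∤ p` (a level-LOWERED partner at `v`, or `E` level-raised at `v`):
`θ_* 𝓢_v(E) ≤ 𝓢_v(A)` (`mem_unramifiedKer_iff_h1Equiv_mem` + Gross (7.1)
`unramifiedKer_le_selmerLocalKer` for `A`), i.e. `ι_v(θ) = 1` — kind (iv) of the census
(`HOME/b2b-bsdres-x11a/g26/SELMER-COMPANION-CENSUS.md` §5: at `p = 3` it takes the route from 28 to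
53 residue cells of N7). Over `ℚ` the inertia hypothesis is discharged at every odd prime
(`…_rat`); the count with four kinds and shape A of file III with kind (iv) follow in file V
(`X11a/SelmerCompanionKinds.lean`).

References: [SilvermanATAEC1994] Ch. V Lemma 5.2 (c), Thm. 5.3, Cor. 5.4, Ex. 5.11;
[SilvermanAEC2009] Cor. X.4.4 (the good-reduction analogue, tree `selmerLocalKer_le_unramifiedKer`);
[GrossLMS1991] (7.1); [NeukirchANT1999] II (9.3), (9.11) (inertia and the valuation);
[MazurRubin2004] §2.3; HOME/b2b-bsdres-x11a/REPORT-g26.md.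
-/

set_option autoImplicit false

noncomputable section

open scoped Classical NNReal

open WeierstrassCurve Literature.NumberTheory.EllipticCurves
  Literature.NumberTheory.GaloisRepresentations Field NumberField IsDedekindDomain
  Literature.NumberTheory.EllipticCurves.Rank1Residual
  Literature.NumberTheory.EllipticCurves.Rank1Residual.Typed

namespace Summit.BirchSwinnertonDyer.Rank1Residual.X11a.SelmerCompanion

section Local

variable {K : Type} [Field K] [NumberField K] (W : WeierstrassCurve K) [W.IsElliptic]
  {p : ℕ} [hp : Fact p.Prime] (v : HeightOneSpectrum (𝓞 K))

/-- **L-ns: at a NON-SPLIT multiplicative place `v ∤ p` whose inertia fixes `√γ`, a class of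
`H¹(K, E[p])` satisfying the local Selmer condition is unramified** (at the prime of `\bar ℤ_K` above
`v` cut out by the canonical embedding `K̄ → K̄_v` and a prime `𝔐` of `\bar 𝓞_v`). Hypotheses:
`p` odd; `E` multiplicative at `v` (`hW`); `γ(E) = −c₄/c₆` not a square in `K_v` (`hγ`, non-split);
`v ∤ p` (`hpv`); the local inertia group fixes every square root of `γ` (`ht`); twisted Tate
uniformisation (`hU`). Proof in the module docstring. [cite: SilvermanATAEC1994, Ch. V Lemma 5.2 (c),
Thm. 5.3, Cor. 5.4] [cite: SilvermanAEC2009, Cor. X.4.4] [cite: NeukirchANT1999, Ch. II (9.3), (9.11)] -/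
theorem selmerLocalKer_le_unramifiedKer_primeBelow_of_nonsplit
    (hU : Silverman1994_thmV53_corV54_tateUniformisation.{0}) (hp2 : p ≠ 2)
    (hW : W.HasMultiplicativeReductionAt v)
    (hγ : ∀ r : v.adicCompletion K, algebraMap K (v.adicCompletion K) (-(W.c₄ / W.c₆)) ≠ r ^ 2)
    (hpv : (p : 𝓞 K) ∉ v.asIdeal)
    {𝔐 : Ideal v.localAbsIntegers} (h𝔐 : 𝔐 ∈ v.localPrimesAbove)
    (ht : ∀ t : AlgebraicClosure (v.adicCompletion K),
      t ^ 2 = algebraMap (v.adicCompletion K) (AlgebraicClosure (v.adicCompletion K))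
        (algebraMap K (v.adicCompletion K) (-(W.c₄ / W.c₆))) →
      ∀ σ ∈ 𝔐.inertia (absoluteGaloisGroup (v.adicCompletion K)),
        Field.absoluteGaloisGroup.toAlgEquiv (v.adicCompletion K) σ t = t)
    {c : galH1Torsion W (p : ℤ)} (hc : c ∈ selmerLocalKer W (v.adicCompletion K) (p : ℤ)) :
    c ∈ unramifiedKer (geomTorsion W (p : ℤ))
      (v.primeBelow (closureEmb (K := K) (v.adicCompletion K)) 𝔐) := by
  have hpp : p.Prime := hp.out
  haveI : NeZero p := ⟨hpp.ne_zero⟩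
  haveI : CharZero (v.adicCompletion K) := charZero_adicCompletion v
  haveI : CharZero (AlgebraicClosure (v.adicCompletion K)) := charZero_of_injective_algebraMap
      (algebraMap (v.adicCompletion K) (AlgebraicClosure (v.adicCompletion K))).injective
  haveI := h𝔐.1
  haveI := h𝔐.2
  have hn : (p : ℤ) ≠ 0 := by exact_mod_cast hpp.ne_zero
  obtain ⟨k₂, hk₂⟩ : ∃ k₂ : ℕ, p + 1 = 2 * k₂ := by
    obtain ⟨k, hk⟩ := hpp.odd_of_ne_two hp2
    exact ⟨k + 1, by omega⟩
  -- the spectral valuation `w = |·|_v` on `K̄_v`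
  obtain ⟨w, hw⟩ := v.exists_spectralValuation
  have pow_eq_one_aux : ∀ {x : ℝ≥0} {n : ℕ}, n ≠ 0 → x ^ n = 1 → x = 1 := by
    intro x n hn0 hx
    rcases lt_trichotomy x 1 with h | h | h
    · exact absurd hx (ne_of_lt (pow_lt_one₀ zero_le h hn0))
    · exact h
    · exact absurd hx (ne_of_gt (one_lt_pow₀ h hn0))
  -- twisted Tate parametrisation of `E` at `v`
  obtain ⟨q, t, Φ, hq0, hq1, ht0, ht2, -, hker, hequiv₀, hrat⟩ := hU W v hW
  -- the sign `ε(σ) = χ(σ)`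
  obtain ⟨ε, hε_of_fix, hε_of_not⟩ : ∃ ε : (absoluteGaloisGroup (v.adicCompletion K)) → ℤ,
      (∀ σ, Field.absoluteGaloisGroup.toAlgEquiv (v.adicCompletion K) σ t = t → ε σ = 1) ∧
        (∀ σ, Field.absoluteGaloisGroup.toAlgEquiv (v.adicCompletion K) σ t ≠ t → ε σ = -1) :=
    ⟨fun σ ↦ if Field.absoluteGaloisGroup.toAlgEquiv (v.adicCompletion K) σ t = t then 1 else -1,
      fun σ h ↦ if_pos h, fun σ h ↦ if_neg h⟩
  have hequiv : ∀ (σ : (absoluteGaloisGroup (v.adicCompletion K))) (u : (AlgebraicClosure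
      (v.adicCompletion K))ˣ),
      σ • Φ (Additive.ofMul u) = Φ (Additive.ofMul ((Units.map
          (absoluteGaloisGroup.toAlgEquiv _ σ : AlgebraicClosure (v.adicCompletion K)
          →* AlgebraicClosure (v.adicCompletion K)) u) ^ (ε σ))) := by
    intro σ u
    rw [hequiv₀ σ u, ofMul_zpow, map_zsmul]
    by_cases h : Field.absoluteGaloisGroup.toAlgEquiv (v.adicCompletion K) σ t = t
    · rw [if_pos h, hε_of_fix σ h]
    · rw [if_neg h, hε_of_not σ h]
  have hact_pow : ∀ (σ : (absoluteGaloisGroup (v.adicCompletion K))) (x : (AlgebraicClosure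
      (v.adicCompletion K))ˣ) (n : ℕ),
      (Units.map (absoluteGaloisGroup.toAlgEquiv _ σ : AlgebraicClosure (v.adicCompletion K)
          →* AlgebraicClosure (v.adicCompletion K)) (x ^ n)) ^ (ε σ) = ((Units.map
          (absoluteGaloisGroup.toAlgEquiv _ σ : AlgebraicClosure (v.adicCompletion K)
          →* AlgebraicClosure (v.adicCompletion K)) x) ^ (ε σ)) ^ n := by
    intro σ x n
    rw [map_pow, ← zpow_natCast, ← zpow_mul, mul_comm, zpow_mul, zpow_natCast]
  -- non-split: some `σ₀ ∈ Γ_{K_v}` moves `t` (else `t ∈ K_v` and `γ = t²` is a square)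
  obtain ⟨σ₀, hσ₀⟩ : ∃ σ₀ : absoluteGaloisGroup (v.adicCompletion K),
      Field.absoluteGaloisGroup.toAlgEquiv (v.adicCompletion K) σ₀ t ≠ t := by
    by_contra hall'
    have hall : ∀ σ : absoluteGaloisGroup (v.adicCompletion K),
        Field.absoluteGaloisGroup.toAlgEquiv (v.adicCompletion K) σ t = t :=
      fun σ ↦ not_not.mp (not_exists.mp hall' σ)
    haveI := HeightOneSpectrum.isGalois_algebraicClosure_adicCompletion (v := v) (K := K)
    have hmem : t ∈ (⊥ : IntermediateField (v.adicCompletion K)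
        (AlgebraicClosure (v.adicCompletion K))) := by
      rw [InfiniteGalois.mem_bot_iff_fixed]
      intro f
      have h := hall ((Field.absoluteGaloisGroup.toAlgEquiv (v.adicCompletion K)).symm f)
      rwa [MulEquiv.apply_symm_apply] at h
    obtain ⟨r, hr⟩ := IntermediateField.mem_bot.mp hmem
    refine hγ r ((algebraMap (v.adicCompletion K) (AlgebraicClosure (v.adicCompletion K))).injective
      ?_)
    rw [map_pow, hr, ht2]
  -- the class `c` and a point `a'` trivialising it locally; `a₁ = a' + p a'`
  obtain ⟨φ, rfl⟩ :=
    oneCocycleClass_surjective (discreteTopRep (absoluteGaloisGroup K) (geomTorsion W (p : ℤ))) c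
  have hc' := hc
  rw [selmerLocalKer, oneCocycleClass_mem_resKer_iff] at hc'
  obtain ⟨a', ha'⟩ := hc'
  have ha'' : ∀ σ : (absoluteGaloisGroup (v.adicCompletion K)), pointsMap W (v.adicCompletion K)
      ((φ.1 (resGal (K := K) (v.adicCompletion K) σ) : geomTorsion W (p : ℤ)) :
      geomPoints W) = σ • a' - a' := fun σ ↦ ha' σ
  have hP'fix : ∀ σ : (absoluteGaloisGroup (v.adicCompletion K)), σ • ((p : ℤ) • a') = (p : ℤ)
      • a' := by
    intro σ
    have h0 : (p : ℤ) • (σ • a' - a') = 0 := by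
      rw [← ha'' σ, ← map_zsmul, (mem_geomTorsion_iff W _ _).mp (φ.1 _).2, map_zero]
    rw [W.smul_zsmul_localPoints (p : ℤ) σ a']
    rw [zsmul_sub, sub_eq_zero] at h0
    exact h0
  set a₁ : localPoints W (v.adicCompletion K) := a' + (p : ℤ) • a' with ha₁
  have ha₁' : ∀ σ : (absoluteGaloisGroup (v.adicCompletion K)), pointsMap W (v.adicCompletion K)
      ((φ.1 (resGal (K := K) (v.adicCompletion K) σ) : geomTorsion W (p : ℤ)) :
      geomPoints W) = σ • a₁ - a₁ := by
    intro σ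
    rw [ha'' σ, ha₁, smul_add, hP'fix]
    abel
  have hpa₁ : (p : ℤ) • a₁ = (p + 1 : ℕ) • ((p : ℤ) • a') := by
    rw [ha₁, zsmul_add, succ_nsmul, ← natCast_zsmul ((p : ℤ) • a') p, add_comm]
  -- `p a' = Ψ(u)`, `u ∈ L` of norm in `q^ℤ`; an invariant `u'` with `Ψ(u') = (p+1) p a'`
  obtain ⟨u, huL, huN, hu⟩ := hrat ((p : ℤ) • a') hP'fix
  obtain ⟨u', hu'inv, hu'val⟩ := W.exists_twistInvariant_lift v hq0 Φ hker ht2 ε hε_of_fix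
    hε_of_not k₂ huL huN
  rw [hu, ← hk₂] at hu'val
  -- `|u'|_v = 1`: `σ₀` inverts `u'`
  have hwu' : w (u' : AlgebraicClosure (v.adicCompletion K)) = 1 := by
    have h1 := hu'inv σ₀
    rw [hε_of_not σ₀ hσ₀, zpow_neg, zpow_one, inv_eq_iff_eq_inv] at h1
    have h2 : w ((Units.map (absoluteGaloisGroup.toAlgEquiv _ σ₀ : AlgebraicClosure
        (v.adicCompletion K) →* AlgebraicClosure (v.adicCompletion K)) u' :
        (AlgebraicClosure (v.adicCompletion K))ˣ) : AlgebraicClosure (v.adicCompletion K)) =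
        w (u' : AlgebraicClosure (v.adicCompletion K)) := by
      rw [Units.coe_map, MonoidHom.coe_coe, ← Field.absoluteGaloisGroup.smul_def]
      exact HeightOneSpectrum.spectralValuation_smul hw σ₀ _
    rw [h1, Units.val_inv_eq_inv_val, map_inv₀] at h2
    have hne : w (u' : AlgebraicClosure (v.adicCompletion K)) ≠ 0 :=
      (Valuation.ne_zero_iff w).mpr u'.ne_zero
    have h3 : w (u' : AlgebraicClosure (v.adicCompletion K)) ^ 2 = 1 := by
      rw [sq]
      nth_rewrite 1 [← h2]
      rw [inv_mul_cancel₀ hne]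
    exact pow_eq_one_aux two_ne_zero h3
  -- a `p`-th root `w₀` of `u'`; `|w₀|_v = 1`
  obtain ⟨z, hz⟩ := IsAlgClosed.exists_pow_nat_eq (u' : (AlgebraicClosure
      (v.adicCompletion K))) hpp.pos
  have hz0 : z ≠ 0 := by
    rintro rfl
    rw [zero_pow hpp.ne_zero] at hz
    exact u'.ne_zero hz.symm
  set w₀ : (AlgebraicClosure (v.adicCompletion K))ˣ := Units.mk0 z hz0 with hw₀
  have hwp : w₀ ^ p = u' := Units.ext (by rw [Units.val_pow_eq_pow_val, hw₀, Units.val_mk0, hz])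
  have hwz : w z = 1 := by
    have h : w z ^ p = 1 := by rw [← map_pow, hz, hwu']
    exact pow_eq_one_aux hpp.ne_zero h
  set R : localPoints W (v.adicCompletion K) := Φ (Additive.ofMul w₀) with hR
  have hRp : (p : ℤ) • R = (p : ℤ) • a₁ := by
    rw [hR, ← map_zsmul, ← ofMul_zpow, zpow_natCast, hwp, hu'val, hpa₁]
  set T : localPoints W (v.adicCompletion K) := a₁ - R with hT
  have hTp : (p : ℤ) • T = 0 := by rw [hT, zsmul_sub, hRp, sub_self]
  set e := W.torsionPointsEquiv (p : ℤ) (E := (v.adicCompletion K)) hn with he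
  set Tt : AddSubgroup.torsionBy (localPoints W (v.adicCompletion K)) (p : ℤ) :=
    ⟨T, (Submodule.mem_torsionBy_iff _ _).mpr hTp⟩ with hTt
  set T₀ : geomTorsion W (p : ℤ) := e.symm Tt with hT₀
  have hT₀ : pointsMap W (v.adicCompletion K) (T₀ : geomPoints W) = T := by
    rw [hT₀, he, W.pointsMap_torsionPointsEquiv_symm (p : ℤ) hn Tt]
  -- `ζ_σ` with `(σ w₀)^{ε σ} = ζ_σ w₀`; `ζ_σ^p = 1`
  obtain ⟨ζf, hζf⟩ : ∃ ζf : (absoluteGaloisGroup (v.adicCompletion K)) → (AlgebraicClosure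
      (v.adicCompletion K))ˣ, ∀ σ, (Units.map
      (absoluteGaloisGroup.toAlgEquiv _ σ : AlgebraicClosure (v.adicCompletion K)
      →* AlgebraicClosure (v.adicCompletion K)) w₀) ^ (ε σ) = ζf σ * w₀ :=
    ⟨fun σ ↦ (Units.map (absoluteGaloisGroup.toAlgEquiv _ σ : AlgebraicClosure
        (v.adicCompletion K) →* AlgebraicClosure (v.adicCompletion K)) w₀) ^ (ε σ) / w₀,
        fun σ ↦ by rw [div_mul_cancel]⟩
  have hζσ : ∀ σ : (absoluteGaloisGroup (v.adicCompletion K)), (ζf σ) ^ p = 1 := by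
    intro σ
    have h : ((Units.map (absoluteGaloisGroup.toAlgEquiv _ σ : AlgebraicClosure
        (v.adicCompletion K) →* AlgebraicClosure (v.adicCompletion K)) w₀) ^ (ε σ)) ^ p =
        (ζf σ * w₀) ^ p := by
      rw [hζf σ]
    rw [← hact_pow, hwp, hu'inv σ, mul_pow, hwp] at h
    exact (mul_right_cancel (by rw [one_mul]; exact h.symm)).symm.symm
  have hmemζ : ∀ {ζ : (AlgebraicClosure (v.adicCompletion K))ˣ}, ζ ^ p = 1 →
      Φ (Additive.ofMul ζ) ∈ AddSubgroup.torsionBy (localPoints W (v.adicCompletion K)) (p : ℤ) :=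
    fun hζ ↦ (Submodule.mem_torsionBy_iff _ _).mpr (W.zsmul_map_ofMul_eq_zero_of_pow_eq_one v Φ hζ)
  -- the local cocycle: `φ(res σ) = e⁻¹ Ψ(ζ_σ) + (res σ • T₀ - T₀)`
  have hφσ : ∀ σ : (absoluteGaloisGroup (v.adicCompletion K)), φ.1 (resGal (K := K)
      (v.adicCompletion K) σ) =
      e.symm ⟨Φ (Additive.ofMul (ζf σ)), hmemζ (hζσ σ)⟩ + (resGal (K := K)
          (v.adicCompletion K) σ • T₀ - T₀) := by
    intro σ
    apply Subtype.ext
    apply pointsMapOfEmb_injective W (closureEmb (K := K) (v.adicCompletion K))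
    change pointsMap W (v.adicCompletion K) _ = pointsMap W (v.adicCompletion K) _
    rw [ha₁' σ, AddSubgroup.coe_add, AddSubgroup.coe_sub, map_add (pointsMap W
        (v.adicCompletion K)),
      map_sub (pointsMap W (v.adicCompletion K)),
      Literature.NumberTheory.EllipticCurves.AddSubgroup.torsionBy.coe_smul, pointsMap_smul, hT₀,
      he, W.pointsMap_torsionPointsEquiv_symm (p : ℤ) hn]
    change σ • a₁ - a₁ = Φ (Additive.ofMul (ζf σ)) + (σ • T - T)
    rw [hT, smul_sub, hR, hequiv σ w₀, hζf σ, ofMul_mul, map_add Φ]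
    abel
  -- INERTIA: `ζ_σ = 1` for `σ ∈ I_𝔐` (inertia fixes `t`, so acts untwisted, fixes `u'`, and moves the
  -- unit `w₀` by less than `1`; distinct `p`-th roots of unity are at distance `1` as `v ∤ p`)
  have hwpval : w (p : AlgebraicClosure (v.adicCompletion K)) = 1 := by
    have h := HeightOneSpectrum.spectralValuation_intCast_eq_one hw (n := (p : ℤ))
      (by rwa [Int.cast_natCast])
    rwa [Int.cast_natCast] at h
  have hζI : ∀ σ ∈ 𝔐.inertia (absoluteGaloisGroup (v.adicCompletion K)), ζf σ = 1 := by
    intro σ hσ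
    have hεσ : ε σ = 1 := hε_of_fix σ (ht t ht2 σ hσ)
    have h1 := hζf σ
    rw [hεσ, zpow_one] at h1
    -- as elements: `σ z = ζ z`
    have h1' : σ • z = (ζf σ : AlgebraicClosure (v.adicCompletion K)) * z := by
      have h := congrArg (fun x : (AlgebraicClosure (v.adicCompletion K))ˣ ↦
        (x : AlgebraicClosure (v.adicCompletion K))) h1
      simp only [Units.coe_map, MonoidHom.coe_coe, Units.val_mul, hw₀, Units.val_mk0] at h
      rw [Field.absoluteGaloisGroup.smul_def]
      exact h
    have hlt : w (σ • z - z) < 1 :=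
      (HeightOneSpectrum.mem_inertia_iff_spectralValuation hw h𝔐).1 hσ z hwz.le
    rw [h1', ← sub_one_mul, map_mul, hwz, mul_one] at hlt
    have hζp : ((ζf σ : AlgebraicClosure (v.adicCompletion K))) ^ p = 1 := by
      rw [← Units.val_pow_eq_pow_val, hζσ σ, Units.val_one]
    exact Units.ext (eq_one_of_pow_eq_one_of_val_sub_lt_one w hpp.ne_zero hwpval hζp hlt)
  have hφI : ∀ σ ∈ 𝔐.inertia (absoluteGaloisGroup (v.adicCompletion K)),
      φ.1 (resGal (K := K) (v.adicCompletion K) σ) =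
        resGal (K := K) (v.adicCompletion K) σ • T₀ - T₀ := by
    intro σ hσ
    rw [hφσ σ]
    have h0 : (⟨Φ (Additive.ofMul (ζf σ)), hmemζ (hζσ σ)⟩ :
        AddSubgroup.torsionBy (localPoints W (v.adicCompletion K)) (p : ℤ)) = 0 :=
      Subtype.ext (by
        change Φ (Additive.ofMul (ζf σ)) =
          ((0 : AddSubgroup.torsionBy (localPoints W (v.adicCompletion K)) (p : ℤ)) :
            localPoints W (v.adicCompletion K))
        rw [hζI σ hσ, ofMul_one, map_zero, ZeroMemClass.coe_zero])
    rw [h0, map_zero, zero_add]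
  -- GLOBAL: for `τ` in the inertia group of `𝔓 = 𝔓_{ι,𝔐}` pick `σ ∈ I_𝔐` with `res σ = τ`
  rw [unramifiedKer, oneCocycleClass_mem_subgroupResKer_iff]
  refine ⟨T₀, fun τ ↦ ?_⟩
  obtain ⟨σ, hσI, hσ⟩ := HeightOneSpectrum.exists_mem_inertia_apply_eq_holds v
    (closureEmb (K := K) (v.adicCompletion K)) h𝔐 τ.2
  have hres : resGal (K := K) (v.adicCompletion K) σ = (τ : absoluteGaloisGroup K) := by
    rw [resGal_eq]
    exact resGalOfEmb_eq_of_apply_eq _ hσ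
  rw [← hres]
  exact hφI σ hσI

/-- **Kind (iv): the local conditions agree along `θ : E[p] ≃ A[p]` at a place `v ∤ p` where `E`
is NON-SPLIT multiplicative (inertia fixing `√γ(E)`) and `A` has GOOD reduction** — a level-lowered
partner at `v`. `θ_* 𝓢_v(E) ≤ 𝓢_v(A)`: a class Selmer for `E` at `v` is unramified
(`selmerLocalKer_le_unramifiedKer_primeBelow_of_nonsplit`), unramifiedness passes through `θ`
(`mem_unramifiedKer_iff_h1Equiv_mem`), and unramified classes are Selmer for the good curve `A`
(Gross 1991 (7.1), tree `unramifiedKer_le_selmerLocalKer`). So `ι_v(θ) = 1` in the count of file I.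
[cite: SilvermanATAEC1994, Ch. V Thm. 5.3, Cor. 5.4] [cite: GrossLMS1991, §7 (7.1)] -/
theorem h1Equiv_mem_selmerLocalKer_of_nonsplit_of_good
    (hU : Silverman1994_thmV53_corV54_tateUniformisation.{0}) (hp2 : p ≠ 2)
    (A : WeierstrassCurve K) [A.IsElliptic]
    (θ : geomTorsion W (p : ℤ) ≃+ geomTorsion A (p : ℤ))
    (hθ : ∀ (σ : absoluteGaloisGroup K) (P : geomTorsion W (p : ℤ)), θ (σ • P) = σ • θ P)
    (hW : W.HasMultiplicativeReductionAt v)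
    (hγ : ∀ r : v.adicCompletion K, algebraMap K (v.adicCompletion K) (-(W.c₄ / W.c₆)) ≠ r ^ 2)
    (hA : A.HasGoodReductionAt v) (hpv : (p : 𝓞 K) ∉ v.asIdeal)
    (ht : ∀ {𝔐 : Ideal v.localAbsIntegers}, 𝔐 ∈ v.localPrimesAbove →
      ∀ t : AlgebraicClosure (v.adicCompletion K),
      t ^ 2 = algebraMap (v.adicCompletion K) (AlgebraicClosure (v.adicCompletion K))
        (algebraMap K (v.adicCompletion K) (-(W.c₄ / W.c₆))) →
      ∀ σ ∈ 𝔐.inertia (absoluteGaloisGroup (v.adicCompletion K)),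
        Field.absoluteGaloisGroup.toAlgEquiv (v.adicCompletion K) σ t = t)
    {c : galH1Torsion W (p : ℤ)} (hc : c ∈ selmerLocalKer W (v.adicCompletion K) (p : ℤ)) :
    h1Equiv θ hθ c ∈ selmerLocalKer A (v.adicCompletion K) (p : ℤ) := by
  obtain ⟨𝔐, h𝔐⟩ := v.localPrimesAbove_nonempty
  have h𝔓 := HeightOneSpectrum.primeBelow_mem_primesAbove
    (ι := closureEmb (K := K) (v.adicCompletion K)) h𝔐
  have hur := selmerLocalKer_le_unramifiedKer_primeBelow_of_nonsplit W v hU hp2 hW hγ hpv h𝔐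
    (ht h𝔐) hc
  have hpv' : (((p : ℤ)) : 𝓞 K) ∉ v.asIdeal := by rwa [Int.cast_natCast]
  refine A.unramifiedKer_le_selmerLocalKer hA hpv' h𝔓 ?_
  exact (mem_unramifiedKer_iff_h1Equiv_mem A W θ hθ _ c).mp hur

end Local

/-! ### Over `ℚ`: the inertia hypothesis is automatic at odd primes; kind (iv) in the count -/

section Rat

variable (W A : WeierstrassCurve ℚ) [W.IsElliptic] [W.IsGloballyMinimal] [A.IsElliptic]
  (p : ℕ) [hp : Fact p.Prime]

/-- **Kind (iv) over `ℚ`**: for `θ : E[p] ≃ A[p]`, an odd prime `ℓ ≠ p` at which the globally minimal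
`E` has NON-SPLIT multiplicative reduction (`γ(E)` not a square in `ℚ_ℓ`) and `A` good reduction,
`θ_* 𝓢_ℓ(E) ≤ 𝓢_ℓ(A)`. The inertia hypothesis of the general lemma is the tree's
`X2.GreenbergVatsalTateDatumRat.inertia_fix_sqrt_gamma` (`c₄, c₆` are `ℓ`-units, `ℓ` odd).
[cite: SilvermanATAEC1994, Ch. V Thm. 5.3, Cor. 5.4, Ex. 5.11] [cite: GrossLMS1991, §7 (7.1)] -/
theorem h1Equiv_mem_selmerLocalKer_of_nonsplit_of_good_rat
    (hU : Silverman1994_thmV53_corV54_tateUniformisation.{0}) (hp2 : p ≠ 2)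
    (θ : geomTorsion W (p : ℤ) ≃+ geomTorsion A (p : ℤ))
    (hθ : ∀ (σ : absoluteGaloisGroup ℚ) (P : geomTorsion W (p : ℤ)), θ (σ • P) = σ • θ P)
    {v : HeightOneSpectrum (𝓞 ℚ)} {ℓ : ℕ} [Fact ℓ.Prime] (hℓ2 : ℓ ≠ 2)
    (hℓv : (ℓ : 𝓞 ℚ) ∈ v.asIdeal) (hmult : W.HasMultiplicativeReductionAtPrime ℓ)
    (hγ : ∀ r : v.adicCompletion ℚ, algebraMap ℚ (v.adicCompletion ℚ) (-(W.c₄ / W.c₆)) ≠ r ^ 2)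
    (hA : A.HasGoodReductionAt v) (hpv : (p : 𝓞 ℚ) ∉ v.asIdeal)
    {c : galH1Torsion W (p : ℤ)} (hc : c ∈ selmerLocalKer W (v.adicCompletion ℚ) (p : ℤ)) :
    h1Equiv θ hθ c ∈ selmerLocalKer A (v.adicCompletion ℚ) (p : ℤ) := by
  have hW : W.HasMultiplicativeReductionAt v := by
    have hvp : (Rat.HeightOneSpectrum.primesEquiv v : ℕ) = ℓ :=
      Rat.HeightOneSpectrum.primesEquiv_eq_of_natCast_mem v (Fact.out : ℓ.Prime) hℓv
    have h := W.hasMultiplicativeReductionAtPrime_iff_hasMultiplicativeReductionAt_ringOfIntegers v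
    subst hvp
    exact h.mp hmult
  obtain ⟨w, hw⟩ := v.exists_spectralValuation
  refine h1Equiv_mem_selmerLocalKer_of_nonsplit_of_good W v hU hp2 A θ hθ hW hγ hA hpv
    (fun {𝔐} h𝔐 t ht2 σ hσ ↦ ?_) hc
  rw [HeightOneSpectrum.inertia_eq_absInertia hw h𝔐] at hσ
  exact X2.GreenbergVatsalTateDatumRat.inertia_fix_sqrt_gamma W hℓ2 hmult hℓv t ht2 σ hσ

end Rat

end Summit.BirchSwinnertonDyer.Rank1Residual.X11a.SelmerCompanion

end
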